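/-
Copyright: statement-level skeleton of a published paper (lit-balaban cell, Phase-2 proof seat p25, gen 15). No proof
claims beyond what the kernel checks below.
-/
import Literature.MathematicalPhysics.QuantumFieldTheory.BalabanImbrieJaffe1984to88.BIJ88VertexChiShell312
import Literature.MathematicalPhysics.QuantumFieldTheory.BalabanImbrieJaffe1984to88.BIJ88SlotMomentsGauss308

/-!
# `BalabanImbrieJaffe1984to88.BIJ88VertexExpansionFieldLaw312` — T. Bałaban, J. Imbrie, A. Jaffe, *Effective action and
cluster properties of the abelian Higgs model*, Commun. Math. Phys. **114** (1988) 257–315 [BalabanImbrieJaffe1988],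
§5.14 p. 311–312 [PDF 55–56] *"We integrate by parts in the Gaussian expectation (5.14.1). … Then the result of the
integration by parts is ⟨Π_{σ_i}F^{m̄}_{k,loc}(X_{σ_i})⟩ = Σ_{{X_r}} Π_c F^L_{k+1,loc}(X_c) ⟨Π_r F_{k,rem}(X_r)⟩"* — **THE
VERTEX EXPANSION ON THE MODEL OF RECORD**: p25 gen 15's `BIJ88VertexExpansion311.expansion` / `expansion_display`
(integration by parts continued through the legs of the differentiated-down vertices, print's stopping rule, one
component), stated for the finite-dimensional Gaussian `e^{−½⟨Φ,AΦ⟩}e^{⟨ℱ,Φ⟩}dΦ`, carried to p36's law of the fields of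
`W`, `fieldLaw blk Δ ℱ W` (`BIJ88SlotMomentsGauss308`, the §5.13/§5.14 measure of record: `A = prec blk Δ W 1_W`, source
`ℱ|_W`): the normalizations cancel.

statement-level skeleton of published theorems with citation tags; proofs where landed; nothing here is a claim
about the Yang–Mills mass gap

PDF held: `paper:balaban1988-cmp114-bij-abelian-higgs-effective-action` (journal page = PDF page + 256); p. 311–312 = PDF
55–56.

CITATION HEADER (lean-in-tree rule).  lit-balaban cell (HOME `run/shared/lean/pub/lit-balaban/`), Phase 2, seat p25
gen 15; row **C2.Claim@312** of `HOME/lit-balaban-r16/ROWS-C2-part2.md` (owner r16, referee ref-5; head untouched);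
model instance of the same seat's `BIJ88VertexExpansion311` (flip-path item (β)) and of the small-factor bounds of
`BIJ88VertexRemainder312` / `BIJ88VertexChiShell312` (toward item (γ), one component).  USED BY NAME, nothing restated:
`BIJ88VertexIbp311.{lmono, vexp}`, `BIJ88VertexExpansion311.{terms, kfac, tint, cst, remv, expansion, expansion_display}`,
`BIJ88VertexRemainder312.{remv_eq_cap_add_dchi, abs_sum_cap_le}`, `BIJ88VertexChiShell312.abs_sum_dchi_le_shell`,
p36's `BIJ88SlotMomentsGauss308.{fieldLaw, integral_fieldLaw, integral_density_pos}`, `BIJ88PolymerRep5134Gauss.{prec,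
src}`, `BIJ88PolymerRep5134.corner`.

## What is proved (0 `sorry`, standard axioms, no new `Prop` facts, theorems only)
* `abs_remv_div_le_fieldLaw` — EACH REMAINDER TERM CARRIES A SMALL FACTOR, on the law: `|Σ_rem|/Z ≤ (max B 1)^N ·
  (c_M^{m̄+1}·Σ_cap|𝔼_W[…]| + √ℙ_W(shell)·Σ_χ′ c_M^{nv} K z √𝔼_W[Π²])` (from `BIJ88VertexRemainder312.abs_sum_cap_le` and
  `BIJ88VertexChiShell312.abs_sum_dchi_le_shell`);
* `expansion_fieldLaw` — `∫ Π_LΦ·χe^{−V} dℙ_W = Σ_{t ∈ terms L b} coef_t · ∫ Π_{pend t}Φ·(χ|∂_zχ)e^{−V} dℙ_W` (every term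
  against the law `ℙ_W = fieldLaw blk Δ ℱ W`);
* `expansion_display_fieldLaw` — THE p. 312 DISPLAY FOR ONE COMPONENT ON THE LAW: `⟨Π_LΦ·χe^{−V}⟩/⟨χe^{−V}⟩ = F^L +
  Σ_{remainder t} coef_t·⟨Π_{pend t}Φ·(χ|∂_zχ)e^{−V}⟩/⟨χe^{−V}⟩`, `F^L = cst` (all diagrams with `≤ b = m̄` vertices).
HONEST SCOPE: as in `BIJ88VertexExpansion311` (one component, one covariance, fixed order of integrations by parts, no
estimates); the interaction is any polynomial `vpoly c legs` in the fields of `W` and `χ` any `C¹` cutoff with `χe^{−V}`,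
`(∂χ)e^{−V}` bounded — which polynomial / which cutoffs (5.14.1) prescribes is not fixed here.  NOT summit progress; NOT
continuum; NOT Clay.  Imports `BIJ88VertexChiShell312` (p25 gen 15) and `BIJ88SlotMomentsGauss308` (p36 gen 8); modifies
nothing.
-/

noncomputable section

namespace Literature.MathematicalPhysics.QuantumFieldTheory.BalabanImbrieJaffe1984to88.BIJ88VertexExpansionFieldLaw312

open MeasureTheory Matrix Finset
open scoped BigOperators
open Literature.MathematicalPhysics.QuantumFieldTheory.Balaban1983to89
open B2Eq228Conditioning (weight source)
open BIJ88PolymerRep5134 (corner)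
open BIJ88PolymerRep5134Gauss (prec src)
open BIJ88SlotMomentsGauss308 (fieldLaw integral_fieldLaw integral_density_pos)
open BIJ88VertexIbp311 (lmono vexp)
open BIJ88VertexExpansion311 (Kind terms kfac tint cst remv expansion expansion_display)
open BIJ88VertexRemainder312 (remv_eq_cap_add_dchi abs_sum_cap_le)
open BIJ88VertexChiShell312 (abs_sum_dchi_le_shell)

variable {α I : Type} [Fintype α] [DecidableEq α] [Fintype I] [DecidableEq I]
  (blk : α → I) (Δ : Matrix α α ℝ) (ℱ : α → ℝ) (W : Finset I)
variable {ι : Type} [Fintype ι]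

/-- **The expansion identity on the law of the fields of `W`**: every term of `terms L b` integrated against
`fieldLaw blk Δ ℱ W`. [cite: BalabanImbrieJaffe1988, §5.14 p.311–312] -/
theorem expansion_fieldLaw (hPD : (prec blk Δ W (corner ℝ W)).PosDef) (c : ι → ℝ)
    (legs : ι → List ({x : α // blk x ∈ W} → ℝ)) {χ : ({x : α // blk x ∈ W} → ℝ) → ℝ} (hχ : ContDiff ℝ 1 χ)
    {K₀ : ℝ} (h0 : ∀ φ, ‖χ φ * vexp c legs φ‖ ≤ K₀) (h1 : ∀ z, ∃ K, ∀ φ, ‖fderiv ℝ χ φ z * vexp c legs φ‖ ≤ K)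
    (L : List ({x : α // blk x ∈ W} → ℝ)) (b : ℕ) :
    ∫ φ, lmono L φ * (χ φ * vexp c legs φ) ∂(fieldLaw blk Δ ℱ W)
      = ((terms (prec blk Δ W (corner ℝ W)) (src blk ℱ W) c legs L b).map fun t =>
          t.coef * ∫ φ, lmono t.pend φ * (kfac χ t.kind φ * vexp c legs φ) ∂(fieldLaw blk Δ ℱ W)).sum := by
  have hZ := (integral_density_pos blk Δ ℱ W hPD).ne'
  rw [integral_fieldLaw, expansion hPD hχ h0 h1 L b, div_eq_mul_inv, ← List.sum_map_mul_right]
  congr 1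
  refine List.map_congr_left fun t _ => ?_
  rw [integral_fieldLaw, tint, div_eq_mul_inv, mul_assoc]

/-- **THE p. 312 DISPLAY FOR ONE COMPONENT ON THE LAW OF THE FIELDS OF `W`** — *"⟨Π_{σ_i}F^{m̄}_{k,loc}(X_{σ_i})⟩ =
Σ Π_c F^L_{k+1,loc}(X_c) ⟨Π_r F_{k,rem}(X_r)⟩"*: in the expectation of `fieldLaw blk Δ ℱ W` carrying the weight
`χe^{−V}`, the monomial observable `Π_LΦ` equals `F^L = cst` (all complete contraction diagrams with at most `b = m̄`
interaction vertices differentiated down, no `χ′`) plus the normalized remainder terms (each with a `χ′` or exactly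
`m̄+1` vertices, `terms_sound`). [cite: BalabanImbrieJaffe1988, §5.14 p.312] -/
theorem expansion_display_fieldLaw (hPD : (prec blk Δ W (corner ℝ W)).PosDef) (c : ι → ℝ)
    (legs : ι → List ({x : α // blk x ∈ W} → ℝ)) {χ : ({x : α // blk x ∈ W} → ℝ) → ℝ} (hχ : ContDiff ℝ 1 χ)
    {K₀ : ℝ} (h0 : ∀ φ, ‖χ φ * vexp c legs φ‖ ≤ K₀) (h1 : ∀ z, ∃ K, ∀ φ, ‖fderiv ℝ χ φ z * vexp c legs φ‖ ≤ K)
    (hZ : ∫ φ, χ φ * vexp c legs φ ∂(fieldLaw blk Δ ℱ W) ≠ 0) (L : List ({x : α // blk x ∈ W} → ℝ)) (b : ℕ) :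
    (∫ φ, lmono L φ * (χ φ * vexp c legs φ) ∂(fieldLaw blk Δ ℱ W)) / (∫ φ, χ φ * vexp c legs φ ∂(fieldLaw blk Δ ℱ W))
      = cst (prec blk Δ W (corner ℝ W)) (src blk ℱ W) c legs L b
        + ((terms (prec blk Δ W (corner ℝ W)) (src blk ℱ W) c legs L b).map fun t =>
            match t.kind with
            | .const => 0
            | _ => t.coef * ∫ φ, lmono t.pend φ * (kfac χ t.kind φ * vexp c legs φ) ∂(fieldLaw blk Δ ℱ W)).sum
          / ∫ φ, χ φ * vexp c legs φ ∂(fieldLaw blk Δ ℱ W) := by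
  have hD := (integral_density_pos blk Δ ℱ W hPD).ne'
  have hZ' : ∫ φ, χ φ * vexp c legs φ *
      (weight (prec blk Δ W (corner ℝ W)) φ * source (src blk ℱ W) φ) ≠ 0 := by
    intro h
    apply hZ
    rw [integral_fieldLaw, h, zero_div]
  -- the remainder sum on the law is `remv / Z`
  have hrem : ((terms (prec blk Δ W (corner ℝ W)) (src blk ℱ W) c legs L b).map fun t =>
        match t.kind with
        | .const => 0
        | _ => t.coef * ∫ φ, lmono t.pend φ * (kfac χ t.kind φ * vexp c legs φ) ∂(fieldLaw blk Δ ℱ W)).sum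
      = remv (prec blk Δ W (corner ℝ W)) (src blk ℱ W) χ c legs L b
        * (∫ φ, weight (prec blk Δ W (corner ℝ W)) φ * source (src blk ℱ W) φ)⁻¹ := by
    rw [remv, ← List.sum_map_mul_right]
    congr 1
    refine List.map_congr_left fun t _ => ?_
    rcases hk : t.kind with _ | z | _
    · simp
    · simp only [integral_fieldLaw, tint, hk, div_eq_mul_inv, mul_assoc]
    · simp only [integral_fieldLaw, tint, hk, div_eq_mul_inv, mul_assoc]
  rw [hrem, integral_fieldLaw, integral_fieldLaw, div_div_div_cancel_right₀ hD,
    expansion_display hPD hχ h0 h1 hZ' L b, div_eq_mul_inv _ (_ / _), div_eq_mul_inv, div_eq_mul_inv, mul_inv, inv_inv]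
  congr 1
  field_simp

/-- **EACH REMAINDER TERM CARRIES A SMALL FACTOR, ON THE LAW** (toward p. 312's *"enough small factors to beat these
large factors in the remainder terms"*, one component): with `Z = ∫e^{−½⟨Φ,AΦ⟩+⟨ℱ,Φ⟩}dΦ` the normalization of
`ℙ_W = fieldLaw blk Δ ℱ W`, brackets bounded by `B` on `Dir ⊇` legs and vertex legs, `|c_m| ≤ c_M`, arities `≤ D`,
`|(∂_zχ)e^{−V}| ≤ K z` and `Dχ = 0` off the shell `Sh`:
`|Σ_rem|/Z ≤ (max B 1)^{|L|+1+bD} · ( c_M^{b+1} · Σ_cap |𝔼_W[Π_{pend}Φ·χe^{−V}]| + √ℙ_W(Sh) · Σ_χ′ c_M^{nv}·K z·√𝔼_W[Π_{pend++pend}Φ] )`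
— the `cap` terms carry `c_M^{m̄+1}`, the `χ′` terms `√ℙ_W(shell)`. [cite: BalabanImbrieJaffe1988, §5.14 p.312] -/
theorem abs_remv_div_le_fieldLaw (hPD : (prec blk Δ W (corner ℝ W)).PosDef) {c : ι → ℝ}
    {legs : ι → List ({x : α // blk x ∈ W} → ℝ)} {χ : ({x : α // blk x ∈ W} → ℝ) → ℝ} (hχ : ContDiff ℝ 1 χ)
    {Dir : Set ({x : α // blk x ∈ W} → ℝ)} {B cM : ℝ}
    (hB : ∀ u ∈ Dir, ∀ v ∈ Dir, |((prec blk Δ W (corner ℝ W))⁻¹ *ᵥ u) ⬝ᵥ v| ≤ B)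
    (hBf : ∀ u ∈ Dir, |((prec blk Δ W (corner ℝ W))⁻¹ *ᵥ u) ⬝ᵥ src blk ℱ W| ≤ B) (hcM : 0 ≤ cM)
    (hc : ∀ m, |c m| ≤ cM) (hlegs : ∀ m, ∀ w ∈ legs m, w ∈ Dir) {D : ℕ} (hD : ∀ m, (legs m).length ≤ D)
    {K : ({x : α // blk x ∈ W} → ℝ) → ℝ} (hK : ∀ z φ, |fderiv ℝ χ φ z * vexp c legs φ| ≤ K z)
    {Sh : Set ({x : α // blk x ∈ W} → ℝ)} (hSh : MeasurableSet Sh) (hχS : ∀ φ, φ ∉ Sh → fderiv ℝ χ φ = 0)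
    {L : List ({x : α // blk x ∈ W} → ℝ)} (hL : ∀ w ∈ L, w ∈ Dir) (b : ℕ) :
    |remv (prec blk Δ W (corner ℝ W)) (src blk ℱ W) χ c legs L b|
        / (∫ φ, weight (prec blk Δ W (corner ℝ W)) φ * source (src blk ℱ W) φ)
      ≤ (max B 1) ^ (L.length + 1 + b * D) *
        (cM ^ (b + 1) * ((terms (prec blk Δ W (corner ℝ W)) (src blk ℱ W) c legs L b).map fun t =>
            match t.kind with
            | .cap => |∫ φ, lmono t.pend φ * (χ φ * vexp c legs φ) ∂(fieldLaw blk Δ ℱ W)|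
            | _ => 0).sum
          + Real.sqrt (∫ φ, Sh.indicator (fun _ => (1 : ℝ)) φ ∂(fieldLaw blk Δ ℱ W)) *
            ((terms (prec blk Δ W (corner ℝ W)) (src blk ℱ W) c legs L b).map fun t =>
              match t.kind with
              | .dchi z => cM ^ t.nv * K z * Real.sqrt (∫ φ, lmono (t.pend ++ t.pend) φ ∂(fieldLaw blk Δ ℱ W))
              | _ => 0).sum) := by
  set A : Matrix {x : α // blk x ∈ W} {x : α // blk x ∈ W} ℝ := prec blk Δ W (corner ℝ W) with hAdef
  set f : {x : α // blk x ∈ W} → ℝ := src blk ℱ W with hfdef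
  set Z : ℝ := ∫ φ : {x : α // blk x ∈ W} → ℝ, weight A φ * source f φ with hZdef
  have hZ : 0 < Z := integral_density_pos blk Δ ℱ W hPD
  have hsq : Real.sqrt Z * Real.sqrt Z = Z := Real.mul_self_sqrt hZ.le
  have hsZ : 0 < Real.sqrt Z := Real.sqrt_pos.2 hZ
  -- raw (unnormalized) quantities
  set C := ((terms A f c legs L b).map fun t => match t.kind with
    | .cap => |∫ φ, lmono t.pend φ * (χ φ * vexp c legs φ) * (weight A φ * source f φ)|
    | _ => 0).sum with hCdef
  set X := ((terms A f c legs L b).map fun t => match t.kind with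
    | .dchi z => cM ^ t.nv * K z * Real.sqrt (∫ φ, lmono (t.pend ++ t.pend) φ * (weight A φ * source f φ))
    | _ => 0).sum with hXdef
  set sR := Real.sqrt (∫ φ, Sh.indicator (fun _ => (1 : ℝ)) φ * (weight A φ * source f φ)) with hsRdef
  -- the normalized sums are the raw ones divided by `Z`, `√Z`
  have eC : ((terms A f c legs L b).map fun t => match t.kind with
      | .cap => |∫ φ, lmono t.pend φ * (χ φ * vexp c legs φ) ∂(fieldLaw blk Δ ℱ W)|
      | _ => 0).sum = C / Z := by
    rw [eq_div_iff hZ.ne', hCdef, ← List.sum_map_mul_right]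
    congr 1
    refine List.map_congr_left fun t _ => ?_
    rcases t.kind with _ | z | _
    · simp
    · simp
    · dsimp only
      rw [integral_fieldLaw, abs_div, abs_of_pos hZ, div_mul_cancel₀ _ hZ.ne']
  have eX : ((terms A f c legs L b).map fun t => match t.kind with
      | .dchi z => cM ^ t.nv * K z * Real.sqrt (∫ φ, lmono (t.pend ++ t.pend) φ ∂(fieldLaw blk Δ ℱ W))
      | _ => 0).sum = X / Real.sqrt Z := by
    rw [eq_div_iff hsZ.ne', hXdef, ← List.sum_map_mul_right]
    congr 1
    refine List.map_congr_left fun t _ => ?_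
    rcases t.kind with _ | z | _
    · simp
    · dsimp only
      rw [integral_fieldLaw, Real.sqrt_div' _ hZ.le, mul_assoc, div_mul_cancel₀ _ hsZ.ne']
    · simp
  have eS : Real.sqrt (∫ φ, Sh.indicator (fun _ => (1 : ℝ)) φ ∂(fieldLaw blk Δ ℱ W)) = sR / Real.sqrt Z := by
    rw [integral_fieldLaw, Real.sqrt_div' _ hZ.le]
  -- the two unnormalized bounds
  have h1 := abs_sum_cap_le (S := {x : α // blk x ∈ W}) (A := A) (f := f) χ hB hBf hcM hc hlegs hD hL b
  have h2 := abs_sum_dchi_le_shell (S := {x : α // blk x ∈ W}) (A := A) (f := f) hPD hχ hB hBf hcM hc hlegs hD hK hSh hχS hL b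
  -- (the per-term summands of `h1`, `h2` are those of `C`, `X`: checked pointwise, kind by kind)
  have hraw : |remv A f χ c legs L b| ≤ (max B 1) ^ (L.length + 1 + b * D) * (cM ^ (b + 1) * C + sR * X) := by
    rw [remv_eq_cap_add_dchi]
    refine (abs_add_le _ _).trans ((add_le_add h1 h2).trans (le_of_eq ?_))
    rw [hCdef, hXdef, hsRdef, mul_add, mul_assoc, mul_assoc]
    congr 3
    · exact congrArg List.sum (List.map_congr_left fun t _ => by rcases t.kind with _ | z | _ <;> rfl)
    · exact congrArg List.sum (List.map_congr_left fun t _ => by rcases t.kind with _ | z | _ <;> rfl)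
  -- divide by `Z` and identify the normalized sums (by `eC`, `eX`, `eS`, up to unfolding of the case splits)
  refine (div_le_div_of_nonneg_right hraw hZ.le).trans_eq ?_
  have er : (max B 1) ^ (L.length + 1 + b * D) * (cM ^ (b + 1) * C + sR * X) / Z
      = (max B 1) ^ (L.length + 1 + b * D) * (cM ^ (b + 1) * (C / Z) + sR / Real.sqrt Z * (X / Real.sqrt Z)) := by
    rw [div_mul_div_comm, hsq]
    ring
  rw [er]
  congr 1
  congr 1
  · congr 1
    exact eC.symm
  · congr 1
    · exact eS.symm
    · exact eX.symm

end Literature.MathematicalPhysics.QuantumFieldTheory.BalabanImbrieJaffe1984to88.BIJ88VertexExpansionFieldLaw312
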